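import Summits.BirchSwinnertonDyer.Rank1Residual.GaloisImage.PropagatedConditionTopOfNoTorsion
import Summits.BirchSwinnertonDyer.Rank1Residual.GaloisImage.TorsionLevelDevissageHigher
import Summits.BirchSwinnertonDyer.Rank1Residual.GaloisImage.KolyvaginScalarTransportLocal
import Literature.NumberTheory.EllipticCurves.KummerSequenceConnecting
import HarnessLib

/-!
# [MR04] Lemma A.1 for `E/ℚ` at `p = 3`, every level: `E(ℚ₃)[3] = 0 ⇒ 𝓕_can(E[3^{k+1}])_{(3)} = H¹(ℚ₃, E[3^{k+1}])`
# (THEOREM B of row T-DER at `v = 3` — the D7 / `KS-vs-KSbar@3` locus of the N11 PORT; file F12)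
# (cell `b2b-bsdres`, team n1011, seat p11 GEN 8, OWNERS row T-DER = skel/T-DER.md STATUS v6)

HONEST FRAMING (cell `b2b-bsdres`, run/shared/lean/b2b/bsd-rank1-residual/, verbatim in every
file): the goal of the cell is to DELETE the COMBINATION-SHAPED residual classes of the
Birch–Swinnerton-Dyer formula for ALL analytic-rank `≤ 1` elliptic curves over `ℚ` — "full BSD
formula for every rank `≤ 1` curve in class `C`" assembled STRICTLY from published theorems — so
that the rank-`≤ 1` remainder becomes exactly the CONSTRUCTION-SHAPED classes, which are TYPED
(missing-input `Prop`s), NOT attempted. This is not "finishing BSD". Team n1011 (X4 ∧ `p = 3`,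
§I N11): research route; TOOL theorems (no definition, no named fact, no `sorry`); nothing booked;
no label / mark / flag text moves.

## What

Mazur–Rubin, App. A, Lemma A.1 ("if `H⁰(ℚ_p, T*)` is divisible then `H¹_𝓕(ℚ_p, T/IT) = H¹(ℚ_p, T/IT)`")
for `T = T_3 E`, `I = 3^{k+1}`, where the hypothesis is `E(ℚ₃)[3] = 0`:
**`propagatedSelmerStructure_three_eq_top_of_torsion_eq_zero`** — for every `k`, the canonical
condition `𝓕_can(E[3^k·3])_{(3)} = im(H¹(ℚ₃, T_3E) → H¹(ℚ₃, E[3^k·3]))` is ALL of `H¹(ℚ₃, E[3^k·3])`.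
Proof by induction on `k`, with NO `H²`: the level-`0` case is F11
(`propagatedSelmerStructureOne_eq_top_of_torsion_eq_zero`, by counting; `𝓕_can(0) = 𝓕̄_one`
definitionally); for the step, given `z ∈ H¹(ℚ₃, E[3^{k+1}·3])`, the induction hypothesis lifts
`red_* z` to `π_{k+1,*}[η]` for a crossed homomorphism `η : Γ_{ℚ₃} → T_3E`; since
`red_* π_{k+2,*} = π_{k+1,*}` (n1011-p11 `Transport.localMap_red_tateLocalMap`), `z − π_{k+2,*}[η]` is
killed by `red_*`, hence — exactness of `H¹(E[3]) → H¹(E[3^{k+1}·3]) → H¹(E[3^k·3])` for the short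
exact sequence `0 → E[3] → E[3^{k+1}·3] →(·3) E[3^k·3] → 0` (n1011-p11 GEN 6
`TorsionLevel.isSES_torsionInclusion_red`, restricted to `Γ_{ℚ₃}` by `IsSES.restrictField`) — equals
`incl_* w` with `w ∈ H¹(ℚ₃, E[3]) = 𝓕̄_one` (F11 again), `w = π_{1,*}[η′]`, and
`incl_* π_{1,*}[η′] = π_{k+2,*}[3^{k+1} η′]` (`Transport.localMap_torsionInclusion_tateLocalMap`); so
`z = π_{k+2,*}[η + 3^{k+1} η′] ∈ 𝓕_can(k+1)`.  The reduction maps `red_k : E[3^{k+1}·3] → E[3^k·3]`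
(multiplication by `3`) are parameters with their specification `hred`, as in the cell's dictionary
files.  Consequence (`mem_propagatedSelmerStructure_three_of_torsion_eq_zero`): under
`E(ℚ₃)[3] = 0` EVERY class of `H¹(ℚ₃, E[3^k·3])` — in particular `loc₃ κ_r` — satisfies the
canonical local condition at `3`: THEOREM B of row T-DER at `v = 3` is vacuous on the D7 rows, and
`KS = K̄S̄` there ([MR04] Thm. 3.2.4, second half).

References: B. Mazur, K. Rubin, Mem. AMS 799 (2004), App. A, Lemma A.1 (p. 79), Thm. 3.2.4;
K. Rubin, PCMS 18 (2011), Thm. 4.3.1 (2), Exercise 3.1.8; J.-P. Serre, *Galois Cohomology*, I §2.2.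
-/

noncomputable section

open scoped Classical NumberField ContRepresentation
open Field NumberField IsDedekindDomain Function
open WeierstrassCurve Literature.NumberTheory.EllipticCurves Literature.NumberTheory.GaloisRepresentations
  Literature.NumberTheory.GaloisRepresentations.DiscreteGaloisModule

namespace Summit.BirchSwinnertonDyer.Rank1Residual.GaloisImage

variable (W : WeierstrassCurve ℚ) [W.IsElliptic]

/-- **[MR04] Lemma A.1 for `E/ℚ`, `p = 3`, every level**: if `E(ℚ₃)[3] = 0` then
`𝓕_can(E[3^k·3])_{(3)} = ⊤` for every `k` (module docstring; induction on `k` from the level-one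
count and the dévissage `0 → E[3] → E[3^{k+1}·3] → E[3^k·3] → 0`, no `H²`).
[cite: MazurRubin2004, App. A, Lemma A.1 (p. 79)] -/
theorem propagatedSelmerStructure_three_eq_top_of_torsion_eq_zero (v : HeightOneSpectrum (𝓞 ℚ))
    (hv : ((3 : ℕ) : 𝓞 ℚ) ∈ v.asIdeal)
    (htors : ∀ P : (W.baseChange (v.adicCompletion ℚ)).toAffine.Point, 3 • P = 0 → P = 0)
    (red : ∀ k : ℕ, (W.torsionGaloisModule (((3 : ℕ) : ℤ) ^ (k + 1) * ((3 : ℕ) : ℤ))).toContRepresentation →ⁱL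
      (W.torsionGaloisModule (((3 : ℕ) : ℤ) ^ k * ((3 : ℕ) : ℤ))).toContRepresentation)
    (hred : ∀ (k : ℕ) (x : geomTorsion W (((3 : ℕ) : ℤ) ^ (k + 1) * ((3 : ℕ) : ℤ))),
      ((red k x : geomTorsion W (((3 : ℕ) : ℤ) ^ k * ((3 : ℕ) : ℤ))) : geomPoints W) =
        ((3 : ℕ) : ℤ) • (x : geomPoints W))
    (k : ℕ) : haveI : Fact (Nat.Prime 3) := ⟨Nat.prime_three⟩
      propagatedSelmerStructure W 3 k (Sum.inr v) = ⊤ := by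
  haveI : Fact (Nat.Prime 3) := ⟨Nat.prime_three⟩
  set V : Place ℚ := Sum.inr v with hV
  -- level one (`𝓕_can(0) = 𝓕̄_one` definitionally), by counting (F11)
  have h1 : propagatedSelmerStructureOne W 3 V = ⊤ :=
    propagatedSelmerStructureOne_eq_top_of_torsion_eq_zero W 3 v hv htors
  induction k with
  | zero => exact h1
  | succ k ih =>
    rw [eq_top_iff]
    intro z _
    -- `red_* z ∈ 𝓕_can(k) = ⊤`: `red_* z = π_{k+1,*}[η]`
    have hz : localMap (red k) V z ∈ propagatedSelmerStructure W 3 k V := by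
      rw [ih]; exact AddSubgroup.mem_top _
    obtain ⟨y, hy⟩ := (mem_propagatedSelmerStructure_iff W 3 k V _).mp hz
    obtain ⟨η, rfl⟩ := oneCocycleClass_surjective (tateLocalRep W 3 V).toTopRep y
    -- `red_* π_{k+2,*}[η] = π_{k+1,*}[η]`
    have hredpow : ∀ x : geomTorsion W (((3 : ℕ) : ℤ) ^ (k + 1) * ((3 : ℕ) : ℤ)),
        ((red k x : geomTorsion W (((3 : ℕ) : ℤ) ^ k * ((3 : ℕ) : ℤ))) : geomPoints W) =
          (((3 : ℕ) : ℤ) ^ ((k + 1) - k)) • (x : geomPoints W) := fun x => by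
      rw [hred, Nat.add_sub_cancel_left, pow_one]
    have hcomp := Transport.localMap_red_tateLocalMap W (Nat.le_succ k) (red k) hredpow V η
    -- the difference is killed by `red_*`
    set z₁ := tateLocalMap W 3 (k + 1) V (oneCocycleClass (tateLocalRep W 3 V).toTopRep η) with hz₁
    have hdiff : localMap (red k) V (z - z₁) = 0 := by
      rw [map_sub, hz₁, hcomp, hy, sub_self]
    -- exactness at the middle of the local short exact sequence
    have hSES := (TorsionLevel.isSES_torsionInclusion_red W k (red k) (hred k)).restrictField
      (Place.Completion V)
    obtain ⟨w, hw⟩ := hSES.exists_map_one_eq_of_map_one_eq_zero (z - z₁) hdiff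
    -- `w ∈ H¹(ℚ₃, E[3]) = 𝓕̄_one = 𝓕_can(0)`: `w = π_{1,*}[η′]`
    have hw0 : w ∈ propagatedSelmerStructure W 3 0 V := by
      change w ∈ propagatedSelmerStructureOne W 3 V
      rw [h1]; exact AddSubgroup.mem_top _
    obtain ⟨y', hy'⟩ := (mem_propagatedSelmerStructure_iff W 3 0 V _).mp hw0
    obtain ⟨η', rfl⟩ := oneCocycleClass_surjective (tateLocalRep W 3 V).toTopRep y'
    -- `incl_* π_{1,*}[η′] = π_{k+2,*}[3^{k+1} η′]`
    have hincl := Transport.localMap_torsionInclusion_tateLocalMap W (Nat.zero_le (k + 1)) V η'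
    -- `z = z₁ + incl_* w ∈ 𝓕_can(k+1)`
    have hzeq : z = z₁ + localMap (W.torsionInclusion (Transport.pow_mul_dvd_pow_mul (Nat.zero_le (k + 1)))) V
        (tateLocalMap W 3 0 V (oneCocycleClass (tateLocalRep W 3 V).toTopRep η')) := by
      rw [hy']
      have hw' : localMap (W.torsionInclusion (Transport.pow_mul_dvd_pow_mul (Nat.zero_le (k + 1)))) V w
          = z - z₁ := hw
      rw [hw', add_sub_cancel]
    rw [hzeq, hincl]
    refine add_mem ?_ ?_
    · exact (mem_propagatedSelmerStructure_iff W 3 (k + 1) V _).mpr ⟨_, rfl⟩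
    · exact (mem_propagatedSelmerStructure_iff W 3 (k + 1) V _).mpr ⟨_, rfl⟩

/-- **THEOREM B of row T-DER at `v = 3` under the D7 certificate**: if `E(ℚ₃)[3] = 0` then EVERY
class of `H¹(ℚ₃, E[3^k·3])` — in particular the localisation at `3` of Kolyvagin's derivative class
`κ_r` — lies in `𝓕_can(E[3^k·3])_{(3)}`; equivalently `KS(E[3^k·3], 𝓕_can) = KS(E[3^k·3], 𝓕_can^{(3)})`
on these rows ([MR04] Thm. 3.2.4, second half / Remark A.5). [cite: MazurRubin2004, App. A, Lemma A.1 (p. 79)] -/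
theorem mem_propagatedSelmerStructure_three_of_torsion_eq_zero (v : HeightOneSpectrum (𝓞 ℚ))
    (hv : ((3 : ℕ) : 𝓞 ℚ) ∈ v.asIdeal)
    (htors : ∀ P : (W.baseChange (v.adicCompletion ℚ)).toAffine.Point, 3 • P = 0 → P = 0)
    (red : ∀ k : ℕ, (W.torsionGaloisModule (((3 : ℕ) : ℤ) ^ (k + 1) * ((3 : ℕ) : ℤ))).toContRepresentation →ⁱL
      (W.torsionGaloisModule (((3 : ℕ) : ℤ) ^ k * ((3 : ℕ) : ℤ))).toContRepresentation)
    (hred : ∀ (k : ℕ) (x : geomTorsion W (((3 : ℕ) : ℤ) ^ (k + 1) * ((3 : ℕ) : ℤ))),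
      ((red k x : geomTorsion W (((3 : ℕ) : ℤ) ^ k * ((3 : ℕ) : ℤ))) : geomPoints W) =
        ((3 : ℕ) : ℤ) • (x : geomPoints W))
    (k : ℕ) (x : galoisCohomology ((W.torsionGaloisModule (((3 : ℕ) : ℤ) ^ k * ((3 : ℕ) : ℤ))).toLocal
      (Sum.inr v : Place ℚ)) 1) :
    haveI : Fact (Nat.Prime 3) := ⟨Nat.prime_three⟩
    x ∈ propagatedSelmerStructure W 3 k (Sum.inr v) := by
  haveI : Fact (Nat.Prime 3) := ⟨Nat.prime_three⟩
  have h := propagatedSelmerStructure_three_eq_top_of_torsion_eq_zero W v hv htors red hred k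
  rw [h]
  exact AddSubgroup.mem_top x

end Summit.BirchSwinnertonDyer.Rank1Residual.GaloisImage

end
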